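import Summits.AtomisticToContinuum.Crystallization.Theorems.FreeSplittingCertificatesStrictSplittingRuleTorusModel552A
import Summits.AtomisticToContinuum.Crystallization.Theorems.FreeSplittingCertificatesStrictSplittingRuleTorusModel552B

/-!
# Torus model 5×5×2: coordinate relabelling (generic dimension) and the covariance CHECK for parity A

Route `FreeSplittingCertificates`, crux `StrictSplittingRule` (stmt-AtomisticToContinuum-12560); unit b2b-freesplit-B (block 2b,
PART B, gen 1).  **VALUE = theorem about a FINITE model — NOT summit progress**; `stub_coreJointCoercive` is not proved.

Same transport as `…TorusModel442AllSites.lean`, for the 5×5×2 instantiation of the generic model: relabelling of the `300` coordinates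
by torus translations (`shiftIdx5`), the covariance CHECKS `cov5A_check` / `cov5B_check` (for each of the 50 even-layer shifts the term
lists generated at the shifted site equal the reference lists relabelled; `native_decide`), `cover5_check`, `norm5_perm_check`,
`sumF5_perm_check` and the transport `jointLMI552_allSites` live in `…TorusModel552AllSites.lean`; this file holds the machinery and
`cov5A_check`; `cov5B_check` is in `…TorusModel552CovB.lean`.  COMPUTATIONAL regime (`native_decide`, `Lean.ofReduceBool`). [folklore]
-/

namespace Summit.AtomisticToContinuum.Crystallization.Theorems.StrictSplittingRuleTorusLMI

open Literature.Computation.Certificates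

/-! ## Relabelling (generic dimension) -/

/-- Relabel a functional (any dimension). [folklore] -/
def LinF.relabelN {n : ℕ} (σ : Fin n → Fin n) (ℓ : LinF n) : LinF n := ℓ.map fun p => (σ p.1, p.2)

/-- Relabel a term (any dimension). [folklore] -/
def shiftTermN {n : ℕ} (σ : Fin n → Fin n) (t : Term n) : Term n := (t.1, LinF.relabelN σ t.2.1, LinF.relabelN σ t.2.2)

/-- A relabelled functional at `u` is the functional at `u ∘ σ`. [folklore] -/
theorem LinF.eval_relabelN {n : ℕ} (σ : Fin n → Fin n) (ℓ : LinF n) (u : Fin n → ℚ) :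
    LinF.eval (LinF.relabelN σ ℓ) u = LinF.eval ℓ (u ∘ σ) := by
  induction ℓ with
  | nil => simp [LinF.relabelN]
  | cons p t ih => simp only [LinF.relabelN, List.map_cons, LinF.eval_cons] at ih ⊢; rw [ih]; rfl

/-- Relabelled term lists at `u` are the original lists at `u ∘ σ`. [folklore] -/
theorem evalQ_mapShiftN {n : ℕ} (σ : Fin n → Fin n) (ts : List (Term n)) (u : Fin n → ℚ) :
    evalQ (ts.map (shiftTermN σ)) u = evalQ ts (u ∘ σ) := by
  induction ts with
  | nil => simp
  | cons t ts ih => simp only [List.map_cons, evalQ_cons, shiftTermN, LinF.eval_relabelN] at ih ⊢; rw [ih]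

/-- `evalQ` is invariant under permutation of the term list (any dimension). [folklore] -/
theorem evalQ_permN {n : ℕ} {ts ts' : List (Term n)} (h : ts.Perm ts') (u : Fin n → ℚ) : evalQ ts u = evalQ ts' u := by
  unfold evalQ; exact (h.map _).sum_eq

/-- `LinF.eval` is invariant under permutation of the entries (any dimension). [folklore] -/
theorem LinF.eval_permN {n : ℕ} {ℓ ℓ' : LinF n} (h : ℓ.Perm ℓ') (u : Fin n → ℚ) : LinF.eval ℓ u = LinF.eval ℓ' u := by
  unfold LinF.eval; exact (h.map _).sum_eq

/-! ## The 5×5×2 translations and the finite checks -/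

/-- The site of a coordinate index of the 5×5×2 torus (`idxG (k,i,j) c = 3(25k+5i+j)+c`). [folklore] -/
def siteOf5 (n : Fin (dimG 4 5)) : SiteG 4 5 :=
  (⟨n.val / 75, by have := n.isLt; simp only [dimG] at this; omega⟩, ⟨n.val / 15 % 5, by omega⟩, ⟨n.val / 3 % 5, by omega⟩)

/-- The component of a coordinate index. [folklore] -/
def compOf5 (n : Fin (dimG 4 5)) : Fin 3 := ⟨n.val % 3, by omega⟩

/-- Relabelling of coordinates induced by the translation `q ↦ q + g`. [folklore] -/
def shiftIdx5 (g : Off) (n : Fin (dimG 4 5)) : Fin (dimG 4 5) := idxG 4 5 (taddG 4 5 (siteOf5 n) g) (compOf5 n)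

/-- Even-layer shifts of the 5×5×2 torus: `dk ∈ {0, 2}`, `di, dj ∈ {0,…,4}` (50 shifts). [folklore] -/
def evenShifts5 : List Off :=
  [(0 : ℤ), 2].flatMap fun dk => (irange 0 4).flatMap fun di => (irange 0 4).map fun dj => (dk, di, dj)

/-- The site-dependent term lists (supply, transfers, κ, readout) of the 5×5×2 model. [folklore] -/
def siteTermLists5 (p : SiteG 4 5) : List (List (Term (dimG 4 5))) :=
  [supplyTermsG 4 5 p (thetaListG 4 5 p), transferTermsG 4 5 p tableClasses552, kappaTermsG 4 5 p (thetaListG 4 5 p),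
    readoutTermsG 4 5 p (thetaListG 4 5 p) betaTable]

/-- **Covariance check, 5×5×2 parity A.**  COMPUTATIONAL (`native_decide`). -/
theorem cov5A_check : ∀ g ∈ evenShifts5,
    siteTermLists5 (taddG 4 5 siteA5 g) = (siteTermLists5 siteA5).map fun ts => ts.map (shiftTermN (shiftIdx5 g)) := by
  native_decide

end Summit.AtomisticToContinuum.Crystallization.Theorems.StrictSplittingRuleTorusLMI
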